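import Mathlib
import Summits.MatrixMultiplication.MatrixMultiplication.Theses.SnSubsetDichotomy
import Summits.MatrixMultiplication.MatrixMultiplication.Theorems.SnSubsetDichotomyUmvirateDescent

/-!
# Line `mover-covering-amgm` for crux `SnSubsetDichotomy.JuntaBranch` (stmt-MatrixMultiplication-8304)

STATUS (lead gen 1, prover-line-stmt-MatrixMultiplication-8304-1, 2026-08-16): **LINE DEAD** — see
`Lines/mover-covering-amgm.dead.md`.  `stub_partnersDisjointOnBand` is inert without `Large`
(`Theorems.JuntaBranch.partnersDisjointOnBand_false_without_large`, p96771) and self-defeating with it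
(gadget planting, lead c1); the only composition-preserving re-cut X_band is inert without `Large`
(`Theorems.JuntaBranch.bandConcentration_false_without_large`, p97311) and equals the crux's open core;
`stub_bandRelocation` is crux-sized (worker verdict in the dead note).  The PROVED content of the line is
in the tree: `Theorems.JuntaBranch.amgmAtom` (p97975) and `windowGain` / `juntaBranch_of_disjointSources`
(Theorems/SnSubsetDichotomyJuntaBranchWindowGain.lean) — BCCGU Thm 4.2 peeling for subsets.  The skeleton
below is kept as registered (stubs `stub_bandRelocation`, `stub_partnersDisjointOnBand`) for the record.

Skeleton (crux-plan, planner-cruxplan-stmt-MatrixMultiplication-8304-mover-covering-amgm-0,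
2026-08-16) of idea card `Cruxes/JuntaBranch/Ideas/mover-covering-amgm.md` (crux-ideate r1,
ideator 1; triage r1-1 **pass**, r1-2 **pass**, r1-3 **pass** — sharpenings built in, see the line
card `Lines/mover-covering-amgm.md`).

THE CRUX (verbatim shape). `JuntaBranch : ∀ ε > 0, ∀ c > 0, ∃ n₀, ∀ n ≥ n₀, ∀ TPP (S,T,U) ⊆ S_n,
Large — (n!)^{3/2} e^{−c√n} ≤ |S||T||U| — and a super-neutral bump — some X ∈ {S,T,U}, level
1 ≤ t ≤ √n, injective I, L with n^{(1/2+ε)t}|X| < |X ∩ U_{I→L}|·n^{(t)} — give an improved triple one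
level down: ∃ n' ∈ [n − √n, n), TPP (S',T',U') ⊆ S_{n'} with
e^{c+1}|S||T||U|(n'!/n!)^{3/2} ≤ |S'||T'||U'|`.

THE LINE (BCCGU's peeling step for subsets, in the band where AM–GM pays). Write
`U_{I→L} = {σ | σ ∘ I = L}`, `X_I := X ∩ U_{I→L}`, `A_k(T) := {j | ∃ τ ∈ T, τ j = L k}` (source
supports of `T` on the block `L`). The one inequality behind BCCGU17 Thm 4.2 (arXiv:1712.02302 p.10,
"∑ aᵢ ≤ n … ∏ aᵢ ≤ (n/t)^t") is isolated from "Young": if the source supports `A_k(T)` are pairwise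
DISJOINT then `∑|A_k| ≤ n`, AM–GM + pigeonhole give an atom `J` with `|T_J| ≥ |T|(t/n)^t`
(`amgmAtom`, PROVED here), and at a block of size `t ≥ t_lo := 2n^{(1−ε̂)/2}` where `S` is
`ε̂`-super-neutral two such partners already pay: `R_S R_T R_U/(n^{(t)})^{3/2} ≥ 2^t ≥ e^{c+1}`
(`windowGain`, PROVED here), so `UmvirateDescent` (route item 8308, the hypothesis `hUD` of `JuntaBranch_of`)
yields the crux's conclusion with `n' = n − t`. The structure theorem the line bets on is
`stub_partnersDisjointOnBand`: in a Large TPP triple with partners inclusion-saturated w.r.t. `S`, at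
an `ε̂`-super-neutral block of `S` of size `t ∈ [t_lo, t_hi]`, `t_hi := c√n/(ε̂ ln n + 2)` (the
B1/T1 packing cap of the triage makes the statement packing-impossible above `≈ c√n/(ε̂ ln n)`; the
band is chosen strictly inside), BOTH partners have pairwise-disjoint source supports on `L`
(= `Q(T) ∩ M_{kk'}(L) = ∅`, all `(n−1)!` movers, not the transposition — triage r1-3 sharpen).
Bumps OUTSIDE the band are the business of `stub_bandRelocation` (triage r1-2 (b),(c), r1-3): a bump
below `t_lo` (down to level 1) either coexists with an `ε̂`-bump of some member inside the band
(aggregation / blockiness) or is paid on the spot by the partners at that very block (partner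
isotropy at `S`'s own low target, packing-consistent because `t_lo ≪ t_B1 = (2c√n−c−1)/(ε ln n)`);
a bump above `t_hi` (rigid top-level bumps, triage r1-1) must coexist with a band bump (the on-the-
spot exit is offered there too but is packing-impossible above `t_B1`, so it carries no content). Inclusion-
saturation of the partners (`exists_saturated`, proved here; the repaired `SaturatedCover` of card
envelope-stability is then available to provers) is supplied to every structural stub for free.

COMPOSITION (kernel-checked, no `sorry` of its own): `JuntaBranch_of (hUD : UmvirateDescent) :
JuntaBranch` — rotate the triple so the bump sits in the first set (`tpp_rotate`), take the
relocation exponent `ε̂ ≤ ε` of `stub_bandRelocation`, case on the level `t`: inside the band of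
`ε̂` → (the `ε`-bump is an `ε̂`-bump) saturate the partners → `stub_partnersDisjointOnBand` →
`amgmAtom` (twice) → `windowGain` → descent; outside → saturate → `stub_bandRelocation`
→ either the band pipeline for the relocated bump (after a second rotation) or descent at the low
block directly; antitonicity of the conclusion in the volume undoes the saturation.

Disproof.lean (cdisprove, `disproof_publish_path` not yet materialised on this hub at planning
time; its theorems are known from the item's evidence notes and the three triage files):
`JuntaBranch_false_without_TPP` — honoured: the TPP is consumed by `stub_bandRelocation`,
`stub_partnersDisjointOnBand` and `UmvirateDescent`, and the pairwise twin T3 of triage r1-2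
(rooted `K'_1, K'_3, K'_5`: pairwise-TPP, bumpy at level 1, jointly flat) is exactly what
`stub_bandRelocation` must separate with the genuine triple condition; `_false_without_N0` —
honoured: every structural stub is asymptotic (`∃ n₀`); "bump hypothesis deleted ⟺ SuperDecay" —
honoured: the bump of `S` is load-bearing in stubs 1, 2 and in `windowGain`; `juntaBranch_iff_restricted`
(WLOG `ε < 1/2`, `c ≥ 1`) — not needed, the stubs are uniform in `ε, c`; `improves_imp_le` /
B1–B5 packing caps (triage r1-1 `tpp_sameTarget_sq_cap`, r1-3 §Caps) — respected: the band's
upper end `c√n/(ε̂ ln n + 2)` keeps Large + super-neutral `S` + two AM–GM partners packing-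
consistent (slack `2c√n(2 − ln θ)/(ε̂ ln n + 2) → ∞`), and the low-block pay-off of stub 1 lives at
`t < t_lo ≪ t_B1`. No `Theorems/JuntaBranch/Negative/*` lemma has landed; `ledger negatives`
(AlgebraicSTPP ×2, DesignFlattening) are unrelated statements — no stub is an instance of one.
-/

open Literature.Combinatorics.Additive
open Summit.MatrixMultiplication.MatrixMultiplication.Theses.SnSubsetDichotomy

set_option linter.dupNamespace false
set_option linter.unusedVariables false

namespace Summit.MatrixMultiplication.MatrixMultiplication.Cruxes.JuntaBranch.MoverCoveringAmgm

/-! ## Vocabulary (each definition is literally a sub-formula of the crux) -/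

section Vocabulary

variable {n : ℕ}

/-- `Large c S T U`: the near-threshold hypothesis of the crux, `(n!)^{3/2} e^{−c√n} ≤ |S||T||U|`. -/
def Large (c : ℝ) (S T U : Finset (Equiv.Perm (Fin n))) : Prop :=
  (n.factorial : ℝ) ^ ((3 : ℝ) / 2) * Real.exp (-(c * Real.sqrt (n : ℝ))) ≤
    ((S.card * T.card * U.card : ℕ) : ℝ)

/-- `SuperNeutral ε X I L`: the block `(I → L)` of `X` is `ε`-super-neutral,
`n^{(1/2+ε)t}|X| < |X ∩ U_{I→L}| · n^{(t)}` — the crux's bump, verbatim. -/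
def SuperNeutral (ε : ℝ) (X : Finset (Equiv.Perm (Fin n))) {t : ℕ} (I L : Fin t → Fin n) : Prop :=
  (n : ℝ) ^ ((1 / 2 + ε) * t) * (X.card : ℝ) <
    ((X.filter (fun σ => ∀ k, σ (I k) = L k)).card : ℝ) * (n.descFactorial t : ℝ)

/-- `DisjointSources T L`: the source supports `A_k(T) = {j | ∃ τ ∈ T, τ j = L k}` of `T` on the
block `L` are pairwise disjoint (equivalently `Q(T)` contains no mover `q`, `q (L k) = L k'`,
`k ≠ k'`). For a Young subgroup `H₂` and a peeled part `B ⊇ L` of `H₁` with `H₁ ∩ H₂ = 1` this is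
"the parts of `H₂` met by `B` are distinct" (BCCGU17 Thm 4.2). -/
def DisjointSources (T : Finset (Equiv.Perm (Fin n))) {t : ℕ} (L : Fin t → Fin n) : Prop :=
  ∀ k k' : Fin t, k ≠ k' → ∀ j : Fin n,
    (∃ τ ∈ T, τ j = L k) → (∃ τ' ∈ T, τ' j = L k') → False

/-- The middle set is inclusion-saturated: no permutation can be added to `T` keeping the TPP. -/
def SaturatedMid (S T U : Finset (Equiv.Perm (Fin n))) : Prop :=
  ∀ g ∉ T, ¬ TripleProductProperty S (insert g T) U

/-- The right set is inclusion-saturated: no permutation can be added to `U` keeping the TPP. -/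
def SaturatedRight (S T U : Finset (Equiv.Perm (Fin n))) : Prop :=
  ∀ g ∉ U, ¬ TripleProductProperty S T (insert g U)

/-- `JointGain c S T U t L I J P`: descending to the atoms `I→L, J→L, P→L` and passing to `S_{n−t}`
multiplies the normalised volume by at least `e^{c+1}` — literally the inequality of the crux's
conclusion with `n' = n − t` and `|S'|,|T'|,|U'|` the three atom sizes (route item
`UmvirateDescent`). -/
def JointGain (c : ℝ) (S T U : Finset (Equiv.Perm (Fin n))) (t : ℕ)
    (L I J P : Fin t → Fin n) : Prop :=
  Real.exp (c + 1) * ((S.card * T.card * U.card : ℕ) : ℝ) *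
      (((n - t).factorial : ℝ) / (n.factorial : ℝ)) ^ ((3 : ℝ) / 2) ≤
    (((S.filter (fun σ => ∀ k, σ (I k) = L k)).card *
        (T.filter (fun σ => ∀ k, σ (J k) = L k)).card *
        (U.filter (fun σ => ∀ k, σ (P k) = L k)).card : ℕ) : ℝ)

end Vocabulary

/-- `ImprovesVol c n V`: the crux's conclusion for a triple of volume `V = |S||T||U|` at level `n`
(it depends on the triple only through `V`, and is antitone in `V`). -/
def ImprovesVol (c : ℝ) (n : ℕ) (V : ℕ) : Prop :=
  ∃ n' : ℕ, (n : ℝ) - Real.sqrt (n : ℝ) ≤ (n' : ℝ) ∧ n' < n ∧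
    ∃ S' T' U' : Finset (Equiv.Perm (Fin n')), TripleProductProperty S' T' U' ∧
      Real.exp (c + 1) * (V : ℝ) * ((n'.factorial : ℝ) / (n.factorial : ℝ)) ^ ((3 : ℝ) / 2) ≤
        ((S'.card * T'.card * U'.card : ℕ) : ℝ)

/-- Lower end of the band: `t_lo(ε̂, n) = 2 n^{(1−ε̂)/2}` — the smallest block size at which two
AM–GM-scale partners pay for an `ε̂`-super-neutral set (`windowGain`: squared base `n^{2ε̂−2}t⁴/2 ≥ 8`). -/
noncomputable def tLo (ε : ℝ) (n : ℕ) : ℝ :=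
  2 * (n : ℝ) ^ ((1 - ε) / 2)

/-- Upper end of the band: `t_hi(ε̂, c, n) = c√n/(ε̂ ln n + 2)`. Chosen strictly below the packing
cap: Large + `ε̂`-super-neutral `S` + two AM–GM partners at a common block of size `θ√n` force
`θ(ε̂ ln n + ln θ) < c` (triage B1 / `tpp_sameTarget_sq_cap`), and `θ = c/(ε̂ ln n + 2)` satisfies it
with slack `→ ∞`. -/
noncomputable def tHi (ε c : ℝ) (n : ℕ) : ℝ :=
  c * Real.sqrt (n : ℝ) / (ε * Real.log (n : ℝ) + 2)

/-! ## The stubs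

Lead reshape r0 (prover-line-stmt-MatrixMultiplication-8304-1, 2026-08-16): the two stub statements
are spelled in ROUTE VOCABULARY (every line definition — `Large`, `SaturatedMid/Right`, `tLo`, `tHi`,
`SuperNeutral`, `DisjointSources`, `JointGain` — unfolded verbatim), so that a `Theorems/` file, which
cannot import this workfile, can prove a registered stub by name + signature; the glue below applies
them unchanged (the definitions are transparent). -/

/-- **Stub 1 — band relocation (bumps outside the band; triage r1-2 (b)+(c), r1-3 "band-relocation
stub").** For every `ε, c > 0` there is an exponent `ε̂ > 0` such that, for `n` large, in a Large TPP
triple `(S,T,U)` whose partners `T, U` are inclusion-saturated w.r.t. `S`, an `ε`-super-neutral block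
`(I→L)` of `S` at a level `t ≤ √n` OUTSIDE the band `[t_lo(ε̂,n), t_hi(ε̂,c,n)]` forces one of:
(a) some member `X ∈ {S,T,U}` has an `ε̂`-super-neutral block `(I'→L')` at a level `t'` INSIDE the
band (and `1 ≤ t' ≤ √n`) — aggregation of small bumps into a window block (Young sanity check: `m`
pointwise-fixed points give `R = n^{(m)}`, super-neutral at every level `m ≥ t_lo`), or restriction
of a band-size sub-block of a bump slightly above `t_hi`; or
(b) the partners pay for the bump on the spot: atoms `J→L`, `P→L` of `T`, `U` with `JointGain c`
at that very block — partner isotropy at `S`'s own target, the way a lone fixed point of a Young set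
is paid by the `√(en)`-parts of its partners (`R_T(j→l) ≈ 0.6√n`). Exit (b) is a real exit only for
LOW bumps: it is packing-consistent for `t < t_lo = 2n^{(1−ε̂)/2} ≪ t_B1 = (2c√n − c − 1)/(ε ln n)`
and packing-IMPOSSIBLE for `t > t_B1` (triage B1, r1-3 §Caps), so above the band (a) is the content.
Why it might fail: RIGID isolated bumps — a thin slice `P ⊆ U_{I→L}` of relative mass
`2n^{(ε−1/2)t}` on a bump-free bulk is super-neutral at level `t` with every proper sub-block
sub-neutral (triage r1-1 remark, r1-3 §Caps); at `t > t_hi` neither (a) by restriction nor any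
same-target descent (B1) is available, so the stub asserts such slices do not occur as members of
Large TPP triples with saturated partners unless a band bump comes with them — a structure claim with
no mechanism yet; and at level 1 the PAIRWISE version is false (T3: rooted `K'_1,K'_3,K'_5` are
pairwise-TPP, bumpy, band-free and jointly flat), so the genuine triple condition must be used.
Uses: TPP, Large, saturation (all load-bearing). Size XL (open). -/
theorem stub_bandRelocation :
    ∀ ε : ℝ, 0 < ε → ∀ c : ℝ, 0 < c → ∃ ε' : ℝ, 0 < ε' ∧ ε' ≤ ε ∧ ∃ n₀ : ℕ, ∀ n ≥ n₀,
      ∀ S T U : Finset (Equiv.Perm (Fin n)), TripleProductProperty S T U →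
      (n.factorial : ℝ) ^ ((3 : ℝ) / 2) * Real.exp (-(c * Real.sqrt (n : ℝ))) ≤
        ((S.card * T.card * U.card : ℕ) : ℝ) →
      (∀ g ∉ T, ¬ TripleProductProperty S (insert g T) U) →
      (∀ g ∉ U, ¬ TripleProductProperty S T (insert g U)) →
      ∀ t : ℕ, 1 ≤ t → (t : ℝ) ≤ Real.sqrt (n : ℝ) →
      ((t : ℝ) < 2 * (n : ℝ) ^ ((1 - ε') / 2) ∨
        c * Real.sqrt (n : ℝ) / (ε' * Real.log (n : ℝ) + 2) < (t : ℝ)) →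
      ∀ I L : Fin t → Fin n, Function.Injective I → Function.Injective L →
      (n : ℝ) ^ ((1 / 2 + ε) * t) * (S.card : ℝ) <
        ((S.filter (fun σ => ∀ k, σ (I k) = L k)).card : ℝ) * (n.descFactorial t : ℝ) →
      (∃ X : Finset (Equiv.Perm (Fin n)), (X = S ∨ X = T ∨ X = U) ∧
          ∃ t' : ℕ, 1 ≤ t' ∧ (t' : ℝ) ≤ Real.sqrt (n : ℝ) ∧ 2 * (n : ℝ) ^ ((1 - ε') / 2) ≤ (t' : ℝ) ∧
            (t' : ℝ) ≤ c * Real.sqrt (n : ℝ) / (ε' * Real.log (n : ℝ) + 2) ∧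
            ∃ I' L' : Fin t' → Fin n, Function.Injective I' ∧ Function.Injective L' ∧
              (n : ℝ) ^ ((1 / 2 + ε') * t') * (X.card : ℝ) <
                ((X.filter (fun σ => ∀ k, σ (I' k) = L' k)).card : ℝ) * (n.descFactorial t' : ℝ)) ∨
        (∃ J P : Fin t → Fin n, Function.Injective J ∧ Function.Injective P ∧
            Real.exp (c + 1) * ((S.card * T.card * U.card : ℕ) : ℝ) *
                (((n - t).factorial : ℝ) / (n.factorial : ℝ)) ^ ((3 : ℝ) / 2) ≤
              (((S.filter (fun σ => ∀ k, σ (I k) = L k)).card *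
                  (T.filter (fun σ => ∀ k, σ (J k) = L k)).card *
                  (U.filter (fun σ => ∀ k, σ (P k) = L k)).card : ℕ) : ℝ)) := by
  sorry

/-- **Stub 2 — partners have disjoint source supports on a band block (THE LEVER; hardest stub).**
For `ε̂, c > 0` and `n` large: in a Large TPP triple `(S,T,U)` with `T, U` inclusion-saturated
w.r.t. `S`, at an `ε̂`-super-neutral block `(I→L)` of `S` of size `t ∈ [t_lo(ε̂,n), t_hi(ε̂,c,n)]`,
BOTH partners have pairwise-disjoint source supports on `L`: no `q ∈ Q(T) ∪ Q(U)` moves a point of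
`L` to another point of `L` (all `(n−1)!` movers of each pair, triage r1-3 sharpen; = the card's
"BlockyPartners"/L-intransitivity, stated directly without the covering detour, triage r1-1/r1-2
sharpen (a)).
Why plausibly true: it is the conclusion BCCGU17 Thm 4.2 extracts in the Young case (parts of `H₂`
met by the peeled block are distinct, from `H₁ ∩ H₂ ∌ (l_k l_{k'})`); for subsets the TPP gives
`Q(T) ∩ Q(S)Q(U) = {1}`, so every mover lying in the product set `Q(S)Q(U)` is excluded from `Q(T)`
(`disjoint_sources_of_moverCovering`, SketchIdeator1, PROVED), and saturation forces the covering
identity `S_n ∖ T ⊆ Q(S)Q(U)T ∪ Q(U)Q(S)T` (repaired `SaturatedCover`, `T ≠ ∅`); the bet is that a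
super-neutral WINDOW block of `S` in a near-threshold triple is blocky (carries the rearranged atoms
`I∘π → L`), which puts the movers of `L` into `Q(S)` itself. Inside the band the statement is
packing-consistent (B1 slack `→ ∞`); above `≈ c√n/(ε̂ ln n)` it would be packing-impossible, which
is why the band stops there.
Why it might fail: disjointness fails identically whenever a partner acts transitively on two points
of `L` (any `T ⊇` a large part of `B_m` at a block transversal to its matching has `A_k(T) = [n]`,
triage r1-3 toy); in the one family where the conclusion is proved (Young) the covering HYPOTHESIS of
the card fails by `e^{Θ(n)}`, so no verified instance of the mechanism exists; 100% of the load sits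
on "near-threshold TPP triples are group-like, hence blocky". Uses: TPP, Large, saturation, the bump,
the band. Size XL (open). -/
theorem stub_partnersDisjointOnBand :
    ∀ ε : ℝ, 0 < ε → ∀ c : ℝ, 0 < c → ∃ n₀ : ℕ, ∀ n ≥ n₀,
      ∀ S T U : Finset (Equiv.Perm (Fin n)), TripleProductProperty S T U →
      (n.factorial : ℝ) ^ ((3 : ℝ) / 2) * Real.exp (-(c * Real.sqrt (n : ℝ))) ≤
        ((S.card * T.card * U.card : ℕ) : ℝ) →
      (∀ g ∉ T, ¬ TripleProductProperty S (insert g T) U) →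
      (∀ g ∉ U, ¬ TripleProductProperty S T (insert g U)) →
      ∀ t : ℕ, 2 * (n : ℝ) ^ ((1 - ε) / 2) ≤ (t : ℝ) →
      (t : ℝ) ≤ c * Real.sqrt (n : ℝ) / (ε * Real.log (n : ℝ) + 2) →
      ∀ I L : Fin t → Fin n, Function.Injective I → Function.Injective L →
      (n : ℝ) ^ ((1 / 2 + ε) * t) * (S.card : ℝ) <
        ((S.filter (fun σ => ∀ k, σ (I k) = L k)).card : ℝ) * (n.descFactorial t : ℝ) →
      (∀ k k' : Fin t, k ≠ k' → ∀ j : Fin n,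
          (∃ τ ∈ T, τ j = L k) → (∃ τ' ∈ T, τ' j = L k') → False) ∧
        (∀ k k' : Fin t, k ≠ k' → ∀ j : Fin n,
          (∃ τ ∈ U, τ j = L k) → (∃ τ' ∈ U, τ' j = L k') → False) := by
  sorry

/-! ## Proved glue (no `sorry` below this line) -/

/-- **The AM–GM atom (PROVED here; BCCGU's `∏ aᵢ ≤ (n/t)^t`, subsets form).** If the source
supports `A_k(T) = {j | ∃ τ ∈ T, τ j = L k}` of `T` on a block `L` are pairwise disjoint, some
injective source tuple `J` carries at least a `(t/n)^t` fraction of `T`: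
`|T|·(t/n)^t ≤ |T ∩ U_{J→L}|`. Proof: the source tuple `τ ↦ (τ⁻¹(L k))_k` maps `T` into
`Fintype.piFinset A` (`∏_k |A_k|` tuples); disjointness in `Fin n` gives `∑_k |A_k| ≤ n`
(`Finset.card_biUnion`), the weighted AM–GM inequality (`Real.geom_mean_le_arith_mean_weighted`,
weights `1/t`) gives `∏_k |A_k| ≤ (n/t)^t`, and the pigeonhole principle
(`Finset.exists_le_card_fiber_of_nsmul_le_card_of_maps_to`) a tuple `y` whose fibre — contained in
the atom `(y → L)` — has `≥ |T|(t/n)^t` elements; `y = τ⁻¹ ∘ L` is injective (or the bound is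
`≤ 0` and `J := L` works). Degenerate cases `t = 0`, `T = ∅` are trivial. No hypothesis on `T`:
scale-free, which is why the lever needs no density (route obstruction O1 void). -/
theorem amgmAtom :
    ∀ n t : ℕ, ∀ T : Finset (Equiv.Perm (Fin n)), ∀ L : Fin t → Fin n, Function.Injective L →
      DisjointSources T L →
      ∃ J : Fin t → Fin n, Function.Injective J ∧
        (T.card : ℝ) * ((t : ℝ) / n) ^ t ≤ ((T.filter (fun σ => ∀ k, σ (J k) = L k)).card : ℝ) := by
  intro n t T L hL hdisj
  classical
  -- trivial cases: `t = 0` and `T = ∅`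
  rcases Nat.eq_zero_or_pos t with rfl | ht
  · exact ⟨L, hL, by simp⟩
  rcases T.eq_empty_or_nonempty with rfl | hT
  · exact ⟨L, hL, by simp⟩
  have hn : 0 < n := Fin.pos (L ⟨0, ht⟩)
  have ht0 : (0 : ℝ) < t := by exact_mod_cast ht
  have hn0 : (0 : ℝ) < n := by exact_mod_cast hn
  -- source supports `A k` and the source-tuple map `f`
  set A : Fin t → Finset (Fin n) := fun k => Finset.univ.filter (fun j => ∃ τ ∈ T, τ j = L k)
    with hA
  set f : Equiv.Perm (Fin n) → (Fin t → Fin n) := fun τ k => τ.symm (L k) with hf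
  have hmaps : ∀ τ ∈ T, f τ ∈ Fintype.piFinset A := by
    intro τ hτ
    rw [Fintype.mem_piFinset]
    intro k
    simp only [hA, Finset.mem_filter, Finset.mem_univ, true_and]
    exact ⟨τ, hτ, by simp [hf]⟩
  obtain ⟨τ₀, hτ₀⟩ := hT
  have hne : (Fintype.piFinset A).Nonempty := ⟨f τ₀, hmaps τ₀ hτ₀⟩
  -- disjoint supports: ∑ |A k| ≤ n
  have hsum : ∑ k, ((A k).card : ℝ) ≤ n := by
    have hdj : ∀ k ∈ (Finset.univ : Finset (Fin t)), ∀ k' ∈ (Finset.univ : Finset (Fin t)),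
        k ≠ k' → Disjoint (A k) (A k') := by
      intro k _ k' _ hkk
      rw [Finset.disjoint_left]
      intro j hj hj'
      simp only [hA, Finset.mem_filter, Finset.mem_univ, true_and] at hj hj'
      exact hdisj k k' hkk j hj hj'
    have h1 : ∑ k, (A k).card = (Finset.univ.biUnion A).card := (Finset.card_biUnion hdj).symm
    have h2 : (Finset.univ.biUnion A).card ≤ n := by
      simpa using Finset.card_le_univ (Finset.univ.biUnion A)
    have h3 : ∑ k, (A k).card ≤ n := h1 ▸ h2
    exact_mod_cast h3
  -- AM–GM: ∏ |A k| ≤ (n/t)^t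
  have hprod : ∏ k, ((A k).card : ℝ) ≤ ((n : ℝ) / t) ^ t := by
    have hwsum : ∑ _k : Fin t, (1 : ℝ) / t = 1 := by
      rw [Finset.sum_const, Finset.card_univ, Fintype.card_fin, nsmul_eq_mul]
      field_simp
    have hw := Real.geom_mean_le_arith_mean_weighted (Finset.univ : Finset (Fin t))
      (fun _ => (1 : ℝ) / t) (fun k => ((A k).card : ℝ)) (fun _ _ => by positivity) hwsum
      (fun _ _ => Nat.cast_nonneg _)
    have hrhs : ∑ k : Fin t, (1 : ℝ) / t * ((A k).card : ℝ) ≤ (n : ℝ) / t := by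
      rw [← Finset.mul_sum]
      calc (1 : ℝ) / t * ∑ k, ((A k).card : ℝ) ≤ (1 : ℝ) / t * n :=
            mul_le_mul_of_nonneg_left hsum (by positivity)
        _ = (n : ℝ) / t := by ring
    have hg0 : 0 ≤ ∏ k : Fin t, ((A k).card : ℝ) ^ ((1 : ℝ) / t) :=
      Finset.prod_nonneg (fun _ _ => by positivity)
    have h1 := pow_le_pow_left₀ hg0 (hw.trans hrhs) t
    have e : (∏ k : Fin t, ((A k).card : ℝ) ^ ((1 : ℝ) / t)) ^ t = ∏ k, ((A k).card : ℝ) := by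
      rw [← Finset.prod_pow]
      apply Finset.prod_congr rfl
      intro k _
      rw [← Real.rpow_natCast, ← Real.rpow_mul (Nat.cast_nonneg _)]
      rw [show (1 : ℝ) / t * ((t : ℕ) : ℝ) = 1 by field_simp]
      exact Real.rpow_one _
    rw [e] at h1
    exact h1
  -- pigeonhole on the source-tuple map
  have hcardpi : ((Fintype.piFinset A).card : ℝ) = ∏ k, ((A k).card : ℝ) := by
    rw [Fintype.card_piFinset, Nat.cast_prod]
  have hq0 : 0 ≤ ((t : ℝ) / n) ^ t := by positivity
  have hb' : (Fintype.piFinset A).card • ((T.card : ℝ) * ((t : ℝ) / n) ^ t) ≤ (T.card : ℝ) := by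
    rw [nsmul_eq_mul, hcardpi]
    have hq : ((n : ℝ) / t) ^ t * ((t : ℝ) / n) ^ t = 1 := by
      rw [← mul_pow, show (n : ℝ) / t * ((t : ℝ) / n) = 1 by field_simp, one_pow]
    calc (∏ k, ((A k).card : ℝ)) * ((T.card : ℝ) * ((t : ℝ) / n) ^ t)
        = (T.card : ℝ) * ((∏ k, ((A k).card : ℝ)) * ((t : ℝ) / n) ^ t) := by ring
      _ ≤ (T.card : ℝ) * (((n : ℝ) / t) ^ t * ((t : ℝ) / n) ^ t) := by gcongr
      _ = (T.card : ℝ) := by rw [hq, mul_one]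
  obtain ⟨y, hy, hfib⟩ := Finset.exists_le_card_fiber_of_nsmul_le_card_of_maps_to hmaps hne hb'
  -- the fibre over `y` is the atom `(y → L)` of `T`
  have hsub : T.filter (fun τ => f τ = y) ⊆ T.filter (fun σ => ∀ k, σ (y k) = L k) := by
    intro τ hτ
    simp only [Finset.mem_filter] at hτ ⊢
    refine ⟨hτ.1, fun k => ?_⟩
    have hk := congrFun hτ.2 k
    simp only [hf] at hk
    rw [← hk]
    simp
  by_cases hfne : (T.filter (fun τ => f τ = y)).Nonempty
  · obtain ⟨τ, hτ⟩ := hfne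
    simp only [Finset.mem_filter] at hτ
    refine ⟨y, ?_, ?_⟩
    · rw [← hτ.2]
      exact τ.symm.injective.comp hL
    · exact hfib.trans (by exact_mod_cast Finset.card_le_card hsub)
  · refine ⟨L, hL, ?_⟩
    rw [Finset.not_nonempty_iff_eq_empty] at hfne
    rw [hfne] at hfib
    simp only [Finset.card_empty, Nat.cast_zero] at hfib
    exact hfib.trans (Nat.cast_nonneg _)

/-- `log 8 > 2` (from `e < 2.7182818286`). -/
theorem two_lt_log_eight : (2 : ℝ) < Real.log 8 := by
  rw [Real.lt_log_iff_exp_lt (by norm_num)]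
  have h := Real.exp_one_lt_d9
  have e : Real.exp 2 = Real.exp 1 ^ 2 := by
    rw [← Real.exp_nat_mul]; norm_num
  rw [e]
  nlinarith [Real.exp_pos 1]

/-- The core real inequality behind `windowGain`: for `n ≥ 4`, `n ≥ (c+1)^4`, `0 < ε < 1/2`,
`2n^{(1-ε)/2} ≤ t ≤ √n` and `D ≥ (n/2)^t`: `e^{2(c+1)} ≤ 8^t ≤ (n^{1+2ε}(t/n)^4(n/2))^t ≤ E² q⁴ D`. -/
theorem windowGain_core (ε c : ℝ) (hε : 0 < ε) (hε2 : ε < 1 / 2) (hc : 0 < c) (n t : ℕ)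
    (hn4 : (4 : ℝ) ≤ n) (hnc : (c + 1) ^ 4 ≤ (n : ℝ)) (htn : (t : ℝ) ≤ Real.sqrt n)
    (hlo : 2 * (n : ℝ) ^ ((1 - ε) / 2) ≤ t) (D : ℝ) (hD : ((n : ℝ) / 2) ^ t ≤ D) :
    Real.exp (c + 1) ^ 2 ≤
      ((n : ℝ) ^ ((1 / 2 + ε) * (t : ℝ))) ^ 2 * (((t : ℝ) / n) ^ t) ^ 4 * D := by
  have hnpos : (0 : ℝ) < n := by linarith
  have hn0 : (0 : ℝ) ≤ n := hnpos.le
  have hn1 : (1 : ℝ) ≤ n := by linarith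
  -- t ≥ 2(c+1)
  have hγ : (1 : ℝ) / 4 ≤ (1 - ε) / 2 := by linarith
  have hnγ : c + 1 ≤ (n : ℝ) ^ ((1 - ε) / 2) := by
    have h1 : (n : ℝ) ^ ((1 : ℝ) / 4) ≤ (n : ℝ) ^ ((1 - ε) / 2) :=
      Real.rpow_le_rpow_of_exponent_le hn1 hγ
    have hc1 : (0 : ℝ) ≤ c + 1 := by linarith
    have h2 : c + 1 ≤ (n : ℝ) ^ ((1 : ℝ) / 4) := by
      calc c + 1 = ((c + 1) ^ 4) ^ ((1 : ℝ) / 4) := by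
            rw [← Real.rpow_natCast, ← Real.rpow_mul hc1]; norm_num
        _ ≤ (n : ℝ) ^ ((1 : ℝ) / 4) := Real.rpow_le_rpow (by positivity) hnc (by norm_num)
    linarith
  have ht2c : 2 * (c + 1) ≤ (t : ℝ) := by linarith
  have ht0 : (0 : ℝ) ≤ t := Nat.cast_nonneg t
  -- exp(c+1)^2 ≤ 8^t
  have h8 : Real.exp (c + 1) ^ 2 ≤ (8 : ℝ) ^ t := by
    rw [← Real.exp_nat_mul]
    have e8 : (8 : ℝ) ^ t = Real.exp (t * Real.log 8) := by
      rw [Real.exp_nat_mul, Real.exp_log (by norm_num)]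
    rw [e8, Real.exp_le_exp]
    have hl := two_lt_log_eight
    push_cast
    nlinarith [mul_nonneg ht0 (sub_nonneg.mpr hl.le)]
  -- t² ≥ 4 n^{1-ε}, t⁴ ≥ 16 n^{2-2ε}
  have hsq : 4 * (n : ℝ) ^ (1 - ε) ≤ (t : ℝ) ^ 2 := by
    have h0 : (0 : ℝ) ≤ 2 * (n : ℝ) ^ ((1 - ε) / 2) := by positivity
    have h1 := pow_le_pow_left₀ h0 hlo 2
    have e : (2 * (n : ℝ) ^ ((1 - ε) / 2)) ^ 2 = 4 * (n : ℝ) ^ (1 - ε) := by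
      rw [mul_pow, ← Real.rpow_natCast ((n : ℝ) ^ ((1 - ε) / 2)) 2, ← Real.rpow_mul hn0]
      norm_num
    rw [e] at h1
    exact h1
  have ht4 : 16 * ((n : ℝ) ^ (1 - ε)) ^ 2 ≤ (t : ℝ) ^ 4 := by
    have h0 : (0 : ℝ) ≤ 4 * (n : ℝ) ^ (1 - ε) := by positivity
    have h1 := pow_le_pow_left₀ h0 hsq 2
    have e1 : (4 * (n : ℝ) ^ (1 - ε)) ^ 2 = 16 * ((n : ℝ) ^ (1 - ε)) ^ 2 := by ring
    have e2 : ((t : ℝ) ^ 2) ^ 2 = (t : ℝ) ^ 4 := by ring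
    rw [e1, e2] at h1
    exact h1
  have key : (n : ℝ) ^ (1 + 2 * ε) * ((n : ℝ) ^ (1 - ε)) ^ 2 = (n : ℝ) ^ 3 := by
    rw [← Real.rpow_natCast ((n : ℝ) ^ (1 - ε)) 2, ← Real.rpow_mul hn0,
      ← Real.rpow_add hnpos]
    rw [show (1 + 2 * ε + (1 - ε) * ((2 : ℕ) : ℝ)) = ((3 : ℕ) : ℝ) by push_cast; ring,
      Real.rpow_natCast]
  have hB : (8 : ℝ) ≤ (n : ℝ) ^ (1 + 2 * ε) * ((t : ℝ) / n) ^ 4 * ((n : ℝ) / 2) := by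
    have hA : 0 ≤ (n : ℝ) ^ (1 + 2 * ε) := by positivity
    calc (8 : ℝ) = (n : ℝ) ^ (1 + 2 * ε) * (16 * ((n : ℝ) ^ (1 - ε)) ^ 2) / (n : ℝ) ^ 4 *
          ((n : ℝ) / 2) := by
          rw [show (n : ℝ) ^ (1 + 2 * ε) * (16 * ((n : ℝ) ^ (1 - ε)) ^ 2) = 16 * (n : ℝ) ^ 3 by
            rw [mul_left_comm, key]]
          field_simp
          ring
      _ ≤ (n : ℝ) ^ (1 + 2 * ε) * (t : ℝ) ^ 4 / (n : ℝ) ^ 4 * ((n : ℝ) / 2) := by gcongr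
      _ = (n : ℝ) ^ (1 + 2 * ε) * ((t : ℝ) / n) ^ 4 * ((n : ℝ) / 2) := by rw [div_pow]; ring
  -- assemble
  have hE2 : ((n : ℝ) ^ ((1 / 2 + ε) * (t : ℝ))) ^ 2 = ((n : ℝ) ^ (1 + 2 * ε)) ^ t := by
    rw [← Real.rpow_natCast ((n : ℝ) ^ ((1 / 2 + ε) * (t : ℝ))) 2, ← Real.rpow_mul hn0,
      ← Real.rpow_natCast ((n : ℝ) ^ (1 + 2 * ε)) t, ← Real.rpow_mul hn0]
    congr 1
    push_cast
    ring
  have hq4 : (((t : ℝ) / n) ^ t) ^ 4 = (((t : ℝ) / n) ^ 4) ^ t := by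
    rw [← pow_mul, ← pow_mul, mul_comm]
  calc Real.exp (c + 1) ^ 2 ≤ (8 : ℝ) ^ t := h8
    _ ≤ ((n : ℝ) ^ (1 + 2 * ε) * ((t : ℝ) / n) ^ 4 * ((n : ℝ) / 2)) ^ t :=
        pow_le_pow_left₀ (by norm_num) hB t
    _ = ((n : ℝ) ^ (1 + 2 * ε)) ^ t * (((t : ℝ) / n) ^ 4) ^ t * ((n : ℝ) / 2) ^ t := by
        rw [mul_pow, mul_pow]
    _ ≤ ((n : ℝ) ^ (1 + 2 * ε)) ^ t * (((t : ℝ) / n) ^ 4) ^ t * D := by gcongr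
    _ = ((n : ℝ) ^ ((1 / 2 + ε) * (t : ℝ))) ^ 2 * (((t : ℝ) / n) ^ t) ^ 4 * D := by
        rw [hE2, hq4]

/-- **The window gain (PROVED here; it was the card's arithmetic, triage-corrected) — why the band
starts at `2n^{(1−ε)/2}`.** For `ε, c > 0` and `n ≥ n₀(ε,c)`, at any block of size `t` with
`t_lo(ε,n) ≤ t ≤ √n`: an `ε`-super-neutral first set and two partners with AM–GM-scale atoms
(`|T_J| ≥ |T|(t/n)^t`, `|U_P| ≥ |U|(t/n)^t`) have `JointGain c` — no TPP, no largeness, pure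
counting: `((n−t)!/n!) = 1/n^{(t)}`, `n^{(t)} ≥ (n+1−t)^t ≥ (n/2)^t`, so the squared gain is
`≥ (n^{2ε−2}t⁴/2)^t ≥ 8^t ≥ e^{2(c+1)}` once `t ≥ t_lo ≥ 2(c+1)` (`n ≥ (c+1)^4 + 4`); for `ε ≥ 1/2`
no set is super-neutral (`n^{(t)} ≤ n^t ≤ n^{(1/2+ε)t}`), so the hypothesis is contradictory. -/
theorem windowGain :
    ∀ ε : ℝ, 0 < ε → ∀ c : ℝ, 0 < c → ∃ n₀ : ℕ, ∀ n ≥ n₀, ∀ t : ℕ,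
      tLo ε n ≤ (t : ℝ) → (t : ℝ) ≤ Real.sqrt (n : ℝ) →
      ∀ S T U : Finset (Equiv.Perm (Fin n)), ∀ L I J P : Fin t → Fin n,
      SuperNeutral ε S I L →
      (T.card : ℝ) * ((t : ℝ) / n) ^ t ≤ ((T.filter (fun σ => ∀ k, σ (J k) = L k)).card : ℝ) →
      (U.card : ℝ) * ((t : ℝ) / n) ^ t ≤ ((U.filter (fun σ => ∀ k, σ (P k) = L k)).card : ℝ) →
      JointGain c S T U t L I J P := by
  intro ε hε c hc
  by_cases hε2 : ε < 1 / 2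
  · refine ⟨⌈(c + 1) ^ 4⌉₊ + 4, ?_⟩
    intro n hn t hlo htn S T U L I J P hS hT hU
    unfold SuperNeutral at hS
    unfold JointGain
    unfold tLo at hlo
    -- basic facts about n, t
    have hn' : ⌈(c + 1) ^ 4⌉₊ + 4 ≤ n := hn
    have hn4 : (4 : ℝ) ≤ n := by
      have h4 : (4 : ℕ) ≤ n := le_trans (Nat.le_add_left 4 _) hn'
      exact_mod_cast h4
    have hnc : (c + 1) ^ 4 ≤ (n : ℝ) := by
      have h1 : ⌈(c + 1) ^ 4⌉₊ ≤ n := le_trans (Nat.le_add_right _ 4) hn'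
      exact le_trans (Nat.le_ceil _) (by exact_mod_cast h1)
    have hnpos : (0 : ℝ) < n := by linarith
    have htn2 : (t : ℝ) ≤ n / 2 := by
      refine le_trans htn ?_
      rw [Real.sqrt_le_left (by positivity)]
      nlinarith
    have htn_nat : t ≤ n := by
      have h : (t : ℝ) ≤ n := by linarith
      exact_mod_cast h
    -- D := n^{(t)} facts
    have hDpos : (0 : ℝ) < (n.descFactorial t : ℝ) := by
      have h : n.descFactorial t ≠ 0 := fun h0 =>
        absurd (Nat.descFactorial_eq_zero_iff_lt.mp h0) (not_lt.mpr htn_nat)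
      exact_mod_cast Nat.pos_of_ne_zero h
    have hDlow : ((n : ℝ) / 2) ^ t ≤ (n.descFactorial t : ℝ) := by
      have h1 : (n + 1 - t) ^ t ≤ n.descFactorial t := Nat.pow_sub_le_descFactorial n t
      have h2 : (n : ℝ) / 2 ≤ ((n + 1 - t : ℕ) : ℝ) := by
        rw [Nat.cast_sub (by omega)]
        push_cast
        linarith
      calc ((n : ℝ) / 2) ^ t ≤ ((n + 1 - t : ℕ) : ℝ) ^ t := pow_le_pow_left₀ (by positivity) h2 t
        _ ≤ (n.descFactorial t : ℝ) := by exact_mod_cast h1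
    -- the ratio (n-t)!/n! = 1/D
    have hf0 : (n.factorial : ℝ) ≠ 0 := by positivity
    have hfac : ((n - t).factorial : ℝ) * (n.descFactorial t : ℝ) = (n.factorial : ℝ) := by
      exact_mod_cast Nat.factorial_mul_descFactorial htn_nat
    have hr : ((n - t).factorial : ℝ) / (n.factorial : ℝ) = (n.descFactorial t : ℝ)⁻¹ := by
      rw [div_eq_iff hf0, ← hfac]
      field_simp
    -- the core inequality and its square root
    have hcore := windowGain_core ε c hε hε2 hc n t hn4 hnc htn hlo (n.descFactorial t : ℝ) hDlow
    have h0 : 0 ≤ (n : ℝ) ^ ((1 / 2 + ε) * (t : ℝ)) * (((t : ℝ) / n) ^ t) ^ 2 *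
        Real.sqrt (n.descFactorial t : ℝ) := by positivity
    have hx : Real.exp (c + 1) ≤ (n : ℝ) ^ ((1 / 2 + ε) * (t : ℝ)) * (((t : ℝ) / n) ^ t) ^ 2 *
        Real.sqrt (n.descFactorial t : ℝ) := by
      have hsq : Real.exp (c + 1) ^ 2 ≤ ((n : ℝ) ^ ((1 / 2 + ε) * (t : ℝ)) *
          (((t : ℝ) / n) ^ t) ^ 2 * Real.sqrt (n.descFactorial t : ℝ)) ^ 2 := by
        calc Real.exp (c + 1) ^ 2 ≤ ((n : ℝ) ^ ((1 / 2 + ε) * (t : ℝ))) ^ 2 *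
              (((t : ℝ) / n) ^ t) ^ 4 * (n.descFactorial t : ℝ) := hcore
          _ = ((n : ℝ) ^ ((1 / 2 + ε) * (t : ℝ)) * (((t : ℝ) / n) ^ t) ^ 2 *
              Real.sqrt (n.descFactorial t : ℝ)) ^ 2 := by
            rw [mul_pow, mul_pow, Real.sq_sqrt hDpos.le]; ring
      have h1 := Real.sqrt_le_sqrt hsq
      rwa [Real.sqrt_sq (Real.exp_pos _).le, Real.sqrt_sq h0] at h1
    -- partner atoms and the bump
    have ha' : (n : ℝ) ^ ((1 / 2 + ε) * (t : ℝ)) * (S.card : ℝ) / (n.descFactorial t : ℝ) ≤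
        ((S.filter (fun σ => ∀ k, σ (I k) = L k)).card : ℝ) := by
      rw [div_le_iff₀ hDpos]
      exact hS.le
    have hq0 : 0 ≤ ((t : ℝ) / n) ^ t := by positivity
    have hprod : ((n : ℝ) ^ ((1 / 2 + ε) * (t : ℝ)) * (S.card : ℝ) / (n.descFactorial t : ℝ)) *
        ((T.card : ℝ) * ((t : ℝ) / n) ^ t) * ((U.card : ℝ) * ((t : ℝ) / n) ^ t) ≤
        ((S.filter (fun σ => ∀ k, σ (I k) = L k)).card : ℝ) *
        ((T.filter (fun σ => ∀ k, σ (J k) = L k)).card : ℝ) *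
        ((U.filter (fun σ => ∀ k, σ (P k) = L k)).card : ℝ) := by
      have h1 := mul_le_mul ha' hT (by positivity) (Nat.cast_nonneg _)
      exact mul_le_mul h1 hU (by positivity) (by positivity)
    -- the key identity √D · (D⁻¹)^{3/2} = D⁻¹
    have hid : Real.sqrt (n.descFactorial t : ℝ) * ((n.descFactorial t : ℝ)⁻¹) ^ ((3 : ℝ) / 2) =
        (n.descFactorial t : ℝ)⁻¹ := by
      rw [Real.sqrt_eq_rpow, Real.inv_rpow hDpos.le, ← Real.rpow_neg hDpos.le,
        ← Real.rpow_add hDpos, show (1 : ℝ) / 2 + -((3 : ℝ) / 2) = -1 by norm_num,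
        Real.rpow_neg_one]
    -- finish
    have hV0 : 0 ≤ ((S.card * T.card * U.card : ℕ) : ℝ) := Nat.cast_nonneg _
    have hr0 : 0 ≤ ((n.descFactorial t : ℝ)⁻¹) ^ ((3 : ℝ) / 2) :=
      Real.rpow_nonneg (inv_nonneg.mpr hDpos.le) _
    rw [hr]
    calc Real.exp (c + 1) * ((S.card * T.card * U.card : ℕ) : ℝ) *
          ((n.descFactorial t : ℝ)⁻¹) ^ ((3 : ℝ) / 2)
        ≤ ((n : ℝ) ^ ((1 / 2 + ε) * (t : ℝ)) * (((t : ℝ) / n) ^ t) ^ 2 *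
            Real.sqrt (n.descFactorial t : ℝ)) * ((S.card * T.card * U.card : ℕ) : ℝ) *
          ((n.descFactorial t : ℝ)⁻¹) ^ ((3 : ℝ) / 2) :=
          mul_le_mul_of_nonneg_right (mul_le_mul_of_nonneg_right hx hV0) hr0
      _ = ((n : ℝ) ^ ((1 / 2 + ε) * (t : ℝ)) * (S.card : ℝ) / (n.descFactorial t : ℝ)) *
          ((T.card : ℝ) * ((t : ℝ) / n) ^ t) * ((U.card : ℝ) * ((t : ℝ) / n) ^ t) := by
          have e : ((n : ℝ) ^ ((1 / 2 + ε) * (t : ℝ)) * (((t : ℝ) / n) ^ t) ^ 2 *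
              Real.sqrt (n.descFactorial t : ℝ)) * ((S.card * T.card * U.card : ℕ) : ℝ) *
              ((n.descFactorial t : ℝ)⁻¹) ^ ((3 : ℝ) / 2) =
              (n : ℝ) ^ ((1 / 2 + ε) * (t : ℝ)) * (((t : ℝ) / n) ^ t) ^ 2 *
              ((S.card * T.card * U.card : ℕ) : ℝ) *
              (Real.sqrt (n.descFactorial t : ℝ) *
                ((n.descFactorial t : ℝ)⁻¹) ^ ((3 : ℝ) / 2)) := by ring
          rw [e, hid]
          push_cast
          field_simp
      _ ≤ _ := hprod
      _ = _ := by push_cast; ring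
  · -- ε ≥ 1/2: no set is ever super-neutral, the hypothesis is contradictory
    refine ⟨1, ?_⟩
    intro n hn t hlo htn S T U L I J P hS hT hU
    exfalso
    unfold SuperNeutral at hS
    have hn1 : (1 : ℝ) ≤ n := by exact_mod_cast hn
    have hε2' : 1 / 2 ≤ ε := not_lt.mp hε2
    have hsub : ((S.filter (fun σ => ∀ k, σ (I k) = L k)).card : ℝ) ≤ (S.card : ℝ) := by
      exact_mod_cast Finset.card_filter_le _ _
    have hD : (n.descFactorial t : ℝ) ≤ (n : ℝ) ^ ((1 / 2 + ε) * (t : ℝ)) := by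
      have h1 : (n.descFactorial t : ℝ) ≤ ((n ^ t : ℕ) : ℝ) := by
        exact_mod_cast Nat.descFactorial_le_pow n t
      have h2 : ((n ^ t : ℕ) : ℝ) = (n : ℝ) ^ ((t : ℕ) : ℝ) := by
        push_cast
        rw [Real.rpow_natCast]
      have h3 : (n : ℝ) ^ ((t : ℕ) : ℝ) ≤ (n : ℝ) ^ ((1 / 2 + ε) * (t : ℝ)) := by
        apply Real.rpow_le_rpow_of_exponent_le hn1
        have ht0 : (0 : ℝ) ≤ t := Nat.cast_nonneg t
        nlinarith
      linarith [h2 ▸ h1]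
    have hE0 : 0 ≤ (n : ℝ) ^ ((1 / 2 + ε) * (t : ℝ)) := by positivity
    have := mul_le_mul hsub hD (Nat.cast_nonneg _) (Nat.cast_nonneg _)
    linarith [mul_comm ((n : ℝ) ^ ((1 / 2 + ε) * (t : ℝ))) (S.card : ℝ)]


/-- The TPP is invariant under cyclic rotation of the triple (conjugate the defining relation by
`s s'⁻¹`). -/
theorem tpp_rotate {G : Type*} [Group G] {S T U : Finset G} (h : TripleProductProperty S T U) :
    TripleProductProperty T U S := by
  intro t ht t' ht' u hu u' hu' s hs s' hs' hprod
  have key : s * s'⁻¹ * (t * t'⁻¹) * (u * u'⁻¹) = 1 := by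
    have e : s * s'⁻¹ * (t * t'⁻¹) * (u * u'⁻¹) =
        (s * s'⁻¹) * (t * t'⁻¹ * (u * u'⁻¹) * (s * s'⁻¹)) * (s * s'⁻¹)⁻¹ := by
      group
    rw [e, hprod]
    group
  obtain ⟨h1, h2, h3⟩ := h s hs s' hs' t ht t' ht' u hu u' hu' key
  exact ⟨h2, h3, h1⟩

section Glue

variable {n : ℕ}

/-- A super-neutral block stays super-neutral for a smaller exponent (`n ≥ 1`). -/
theorem SuperNeutral.mono {ε ε' : ℝ} {X : Finset (Equiv.Perm (Fin n))} {t : ℕ}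
    {I L : Fin t → Fin n} (h : SuperNeutral ε X I L) (hε : ε' ≤ ε) (hn : 1 ≤ n) :
    SuperNeutral ε' X I L := by
  unfold SuperNeutral at *
  refine lt_of_le_of_lt ?_ h
  apply mul_le_mul_of_nonneg_right _ (Nat.cast_nonneg _)
  apply Real.rpow_le_rpow_of_exponent_le (by exact_mod_cast hn)
  have ht : (0 : ℝ) ≤ (t : ℝ) := Nat.cast_nonneg _
  exact mul_le_mul_of_nonneg_right (by linarith) ht

/-- Largeness is invariant under rotation (the volume is a symmetric function). -/
theorem Large.rotate {c : ℝ} {S T U : Finset (Equiv.Perm (Fin n))} (h : Large c S T U) :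
    Large c T U S := by
  unfold Large at *
  have e : T.card * U.card * S.card = S.card * T.card * U.card := by ring
  rw [e]
  exact h

/-- Largeness survives enlarging the partners. -/
theorem Large.mono {c : ℝ} {S T U T' U' : Finset (Equiv.Perm (Fin n))} (h : Large c S T U)
    (hT : T ⊆ T') (hU : U ⊆ U') : Large c S T' U' := by
  unfold Large at *
  refine le_trans h ?_
  exact_mod_cast Nat.mul_le_mul (Nat.mul_le_mul le_rfl (Finset.card_le_card hT))
    (Finset.card_le_card hU)

/-- WLOG-SATURATION (triage r1-1/r1-2/r1-3: a free normal form for the crux as filed): every TPP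
triple sits inside one with the same first set whose partners are inclusion-saturated. -/
theorem exists_saturated (S T U : Finset (Equiv.Perm (Fin n))) (h : TripleProductProperty S T U) :
    ∃ T' U' : Finset (Equiv.Perm (Fin n)), T ⊆ T' ∧ U ⊆ U' ∧ TripleProductProperty S T' U' ∧
      SaturatedMid S T' U' ∧ SaturatedRight S T' U' := by
  classical
  obtain ⟨T', hTT', hT'max⟩ :=
    Finite.exists_le_maximal (p := fun T' : Finset (Equiv.Perm (Fin n)) =>
      TripleProductProperty S T' U) h
  obtain ⟨U', hUU', hU'max⟩ :=
    Finite.exists_le_maximal (p := fun U' : Finset (Equiv.Perm (Fin n)) =>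
      TripleProductProperty S T' U') hT'max.1
  refine ⟨T', U', hTT', hUU', hU'max.1, ?_, ?_⟩
  · intro g hg hins
    have h1 : TripleProductProperty S (insert g T') U :=
      hins.mono subset_rfl subset_rfl hUU'
    have h2 : insert g T' ≤ T' := hT'max.2 h1 (Finset.subset_insert g T')
    exact hg (h2 (Finset.mem_insert_self g T'))
  · intro g hg hins
    have h2 : insert g U' ≤ U' := hU'max.2 hins (Finset.subset_insert g U')
    exact hg (h2 (Finset.mem_insert_self g U'))

/-- The crux's conclusion is antitone in the volume. -/
theorem ImprovesVol.anti {c : ℝ} {V V' : ℕ} (h : ImprovesVol c n V') (hV : V ≤ V') :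
    ImprovesVol c n V := by
  obtain ⟨n', h1, h2, S', T', U', hT, hle⟩ := h
  refine ⟨n', h1, h2, S', T', U', hT, le_trans ?_ hle⟩
  have hVR : (V : ℝ) ≤ (V' : ℝ) := by exact_mod_cast hV
  have hr : 0 ≤ ((n'.factorial : ℝ) / (n.factorial : ℝ)) ^ ((3 : ℝ) / 2) := by positivity
  have he : 0 ≤ Real.exp (c + 1) := (Real.exp_pos _).le
  exact mul_le_mul_of_nonneg_right (mul_le_mul_of_nonneg_left hVR he) hr

/-- DESCENT: a block with `JointGain c` at a level `1 ≤ t ≤ √n` gives the crux's conclusion with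
`n' = n − t`, through the route item `UmvirateDescent` (8308). -/
theorem improvesVol_of_jointGain (hUD : UmvirateDescent) {t : ℕ} {c : ℝ}
    (S T U : Finset (Equiv.Perm (Fin n))) (hTPP : TripleProductProperty S T U)
    (ht1 : 1 ≤ t) (htn : (t : ℝ) ≤ Real.sqrt (n : ℝ))
    (L I J P : Fin t → Fin n) (hL : Function.Injective L) (hI : Function.Injective I)
    (hJ : Function.Injective J) (hP : Function.Injective P)
    (hJG : JointGain c S T U t L I J P) :
    ImprovesVol c n (S.card * T.card * U.card) := by
  have htn' : t ≤ n := by simpa using Fintype.card_le_of_injective L hL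
  obtain ⟨S', T', U', hTPP', hS', hT', hU'⟩ := hUD n t htn' I J P L hI hJ hP hL S T U hTPP
  refine ⟨n - t, ?_, ?_, S', T', U', hTPP', ?_⟩
  · rw [Nat.cast_sub htn']
    linarith
  · omega
  · rw [hS', hT', hU']
    exact hJG

/-- ROTATION WRAPPER: a statement "bump data `Q` on the FIRST set ⇒ improvement" transfers to a bump
on any member `X ∈ {S,T,U}` (rotate the triple until `X` comes first). -/
theorem improves_of_member {c : ℝ} (Q : Finset (Equiv.Perm (Fin n)) → Prop)
    (first : ∀ S T U : Finset (Equiv.Perm (Fin n)), TripleProductProperty S T U → Large c S T U →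
      Q S → ImprovesVol c n (S.card * T.card * U.card))
    (S T U : Finset (Equiv.Perm (Fin n))) (hTPP : TripleProductProperty S T U) (hL : Large c S T U)
    (X : Finset (Equiv.Perm (Fin n))) (hX : X = S ∨ X = T ∨ X = U) (hQ : Q X) :
    ImprovesVol c n (S.card * T.card * U.card) := by
  rcases hX with rfl | rfl | rfl
  · exact first X T U hTPP hL hQ
  · have h := first X U S (tpp_rotate hTPP) hL.rotate hQ
    have e : X.card * U.card * S.card = S.card * X.card * U.card := by ring
    rw [e] at h
    exact h
  · have h := first X S T (tpp_rotate (tpp_rotate hTPP)) hL.rotate.rotate hQ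
    have e : X.card * S.card * T.card = S.card * T.card * X.card := by ring
    rw [e] at h
    exact h

end Glue

/-- THE BAND PIPELINE: an `ε̂`-super-neutral block of the first set inside the band gives the
improvement — saturate the partners, `stub_partnersDisjointOnBand`, `amgmAtom` twice,
`windowGain`, descent, and undo the saturation by antitonicity. -/
theorem band_pipeline (hUD : UmvirateDescent) {ε c : ℝ} (hε : 0 < ε) (hc : 0 < c) :
    ∃ n₀ : ℕ, ∀ n ≥ n₀, ∀ S T U : Finset (Equiv.Perm (Fin n)), TripleProductProperty S T U →
      Large c S T U → ∀ t : ℕ, 1 ≤ t → (t : ℝ) ≤ Real.sqrt (n : ℝ) → tLo ε n ≤ (t : ℝ) →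
      (t : ℝ) ≤ tHi ε c n → ∀ I L : Fin t → Fin n, Function.Injective I → Function.Injective L →
      SuperNeutral ε S I L → ImprovesVol c n (S.card * T.card * U.card) := by
  obtain ⟨n₂, h2⟩ := stub_partnersDisjointOnBand ε hε c hc
  obtain ⟨n₄, h4⟩ := windowGain ε hε c hc
  refine ⟨max n₂ n₄, fun n hn S T U hTPP hLarge t ht1 htn hlo hhi I L hI hL hSN => ?_⟩
  obtain ⟨T', U', hTT', hUU', hTPP', hsatM, hsatR⟩ := exists_saturated S T U hTPP
  have hLarge' : Large c S T' U' := hLarge.mono hTT' hUU'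
  obtain ⟨hdT, hdU⟩ :=
    h2 n (le_of_max_le_left hn) S T' U' hTPP' hLarge' hsatM hsatR t hlo hhi I L hI hL hSN
  obtain ⟨J, hJ, hJb⟩ := amgmAtom n t T' L hL hdT
  obtain ⟨P, hP, hPb⟩ := amgmAtom n t U' L hL hdU
  have hJG : JointGain c S T' U' t L I J P :=
    h4 n (le_of_max_le_right hn) t hlo htn S T' U' L I J P hSN hJb hPb
  have himp := improvesVol_of_jointGain hUD S T' U' hTPP' ht1 htn L I J P hL hI hJ hP hJG
  exact himp.anti (Nat.mul_le_mul (Nat.mul_le_mul le_rfl (Finset.card_le_card hTT'))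
    (Finset.card_le_card hUU'))

/-- MAIN LEMMA (an `ε`-bump in the first set, any level `1 ≤ t ≤ √n`): with the relocation
exponent `ε' ≤ ε` of `stub_bandRelocation`, if `t` lies in the band of `ε'` the bump is
`ε'`-super-neutral (`SuperNeutral.mono`) and the pipeline applies; outside it, saturate and call
`stub_bandRelocation` — either a band bump of some member (pipeline after rotation) or a direct
pay-off at the low block (descent) — and undo the saturation by antitonicity. -/
theorem main_first (hUD : UmvirateDescent) {ε c : ℝ} (hε : 0 < ε) (hc : 0 < c) :
    ∃ n₀ : ℕ, ∀ n ≥ n₀, ∀ S T U : Finset (Equiv.Perm (Fin n)), TripleProductProperty S T U →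
      Large c S T U → ∀ t : ℕ, 1 ≤ t → (t : ℝ) ≤ Real.sqrt (n : ℝ) →
      ∀ I L : Fin t → Fin n, Function.Injective I → Function.Injective L → SuperNeutral ε S I L →
      ImprovesVol c n (S.card * T.card * U.card) := by
  obtain ⟨ε', hε', hε'ε, n₁, h1⟩ := stub_bandRelocation ε hε c hc
  obtain ⟨n₃, hb⟩ := band_pipeline hUD hε' hc
  refine ⟨max n₁ n₃, fun n hn S T U hTPP hLarge t ht1 htn I L hI hL hSN => ?_⟩
  have hn₁ : n₁ ≤ n := le_of_max_le_left hn
  have hn₃ : n₃ ≤ n := le_of_max_le_right hn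
  have hn1 : 1 ≤ n := le_trans ht1 (by simpa using Fintype.card_le_of_injective L hL)
  -- is `t` inside the band of the relocated exponent `ε'`? then run the pipeline at `ε'` directly
  by_cases hin : tLo ε' n ≤ (t : ℝ) ∧ (t : ℝ) ≤ tHi ε' c n
  · exact hb n hn₃ S T U hTPP hLarge t ht1 htn hin.1 hin.2 I L hI hL (hSN.mono hε'ε hn1)
  · have hout : (t : ℝ) < tLo ε' n ∨ tHi ε' c n < (t : ℝ) := by
      rcases not_and_or.mp hin with h | h
      · exact Or.inl (not_le.mp h)
      · exact Or.inr (not_le.mp h)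
    obtain ⟨T', U', hTT', hUU', hTPP', hsatM, hsatR⟩ := exists_saturated S T U hTPP
    have hLarge' : Large c S T' U' := hLarge.mono hTT' hUU'
    have hV : S.card * T.card * U.card ≤ S.card * T'.card * U'.card :=
      Nat.mul_le_mul (Nat.mul_le_mul le_rfl (Finset.card_le_card hTT')) (Finset.card_le_card hUU')
    rcases h1 n hn₁ S T' U' hTPP' hLarge' hsatM hsatR t ht1 htn hout I L hI hL hSN with
      ⟨X, hX, t', ht'1, ht'n, hlo, hhi, I', L', hI', hL', hSN'⟩ | ⟨J, P, hJ, hP, hJG⟩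
    · refine ImprovesVol.anti ?_ hV
      exact improves_of_member (fun Y => SuperNeutral ε' Y I' L')
        (fun A B C hABC hLABC hQ =>
          hb n hn₃ A B C hABC hLABC t' ht'1 ht'n hlo hhi I' L' hI' hL' hQ)
        S T' U' hTPP' hLarge' X hX hSN'
    · exact (improvesVol_of_jointGain hUD S T' U' hTPP' ht1 htn L I J P hL hI hJ hP hJG).anti hV

/-- **The crux from the stubs, given descent** (the route's support item `UmvirateDescent`,
stmt-8308): rotate the bump into the first set and apply `main_first`. -/
theorem JuntaBranch_of_UD (hUD : UmvirateDescent) : JuntaBranch := by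
  intro ε hε c hc
  obtain ⟨n₀, h⟩ := main_first hUD hε hc
  refine ⟨n₀, fun n hn S T U hTPP hLarge hb => ?_⟩
  obtain ⟨X, hX, t, ht1, ht2, I, L, hI, hL, hbump⟩ := hb
  exact improves_of_member (fun Y => SuperNeutral ε Y I L)
    (fun A B C hABC hLABC hQ => h n hn A B C hABC hLABC t ht1 ht2 I L hI hL hQ)
    S T U hTPP hLarge X hX hbump

/-- **The crux from the stubs** (lead gen 1, 2026-08-16: unconditional composition — the descent
hypothesis is discharged by the tree theorem `Theorems.umvirateDescent_proof`, item 8308 closed):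
`JuntaBranch` by name, modulo exactly the two registered stubs `stub_bandRelocation` and
`stub_partnersDisjointOnBand`. -/
theorem JuntaBranch_of : JuntaBranch :=
  JuntaBranch_of_UD Summit.MatrixMultiplication.MatrixMultiplication.Theorems.umvirateDescent_proof

end Summit.MatrixMultiplication.MatrixMultiplication.Cruxes.JuntaBranch.MoverCoveringAmgm
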